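import Literature.NumberTheory.Automorphic.BorelBruhatCellsGK
import HarnessLib

/-!
# The Bruhat cell `B P_σ U_n` inside the translated big cell `P_σ N⁻ B`

Topic `NumberTheory/Automorphic`; namespace `Literature.NumberTheory.Automorphic`. For a permutation
`σ` of `Fin n` and a field `K`, the translate `P_σ N⁻ B` of the opposite big cell (`N⁻` the lower
unitriangular matrices, `B` the invertible upper triangular ones) is an open neighbourhood of the
Bruhat cell `C_σ = B P_σ U_n` (`bruhatCell σ`), and **the cell is cut out linearly in it**:

* `IsLowerUnitriangular.entry_eq_zero_of_swRank_eq`: if `N` is lower unitriangular and the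
  south-west ranks of `P_σ N` are the block counts of `σ` (i.e. `P_σ N ∈ C_σ`), then `N_{kl} = 0`
  for every `l < k` with `σ⁻¹ l < σ⁻¹ k` — that is, `P_σ N P_σ⁻¹` is upper triangular;
* `entry_eq_zero_of_permGL_mul_mem_bruhatCell`: the same for `P_σ N d u ∈ C_σ` with `d` diagonal
  invertible and `u ∈ U_n` (so `C_σ ∩ P_σ N⁻ B ⊆ P_σ (N⁻ ∩ P_σ⁻¹ U_n P_σ) B`);
* `permGL_mul_mem_bruhatCell_of_entry_eq_zero`: conversely such elements lie in `C_σ`.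

The proof of the first statement is a rank count: if `N_{kl} ≠ 0`, the rows `σ⁻¹ c`
(`c < l`, `σ⁻¹ c > σ⁻¹ l`) and `σ⁻¹ k` of `P_σ N`, restricted to the columns `≤ l`, contain a lower
triangular square block with non-zero diagonal of size `blockCount σ (σ⁻¹ l + 1) (l + 1) + 1`, so the
south-west rank at `(σ⁻¹ l + 1, l + 1)` exceeds the block count (Fulton 1997, §10.2: the Schubert cell
is the set where the rank conditions hold with equality; Borel 1991, 14.12: `U = U_w · U'_w`).
Used for the archimedean Gelfand–Kazhdan argument on `GL_n` (Shalika 1974, §2–§3), where a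
distribution supported on a small cell is studied in the chart `P_σ N⁻ B`.

Everything is proved; no named fact is introduced.

## References

* W. Fulton, *Young Tableaux* (1997), §10.2 (rank conditions for Schubert cells). [FultonYoungTableaux1997]
* A. Borel, *Linear Algebraic Groups*, 2nd ed. (1991), §14.12 (the cell `U_w ẇ B`, `U = U_w U'_w`). [Borel1991]
* J. A. Shalika, *The multiplicity one theorem for `GL_n`*, Ann. of Math. 100 (1974), §2. [Shalika1974]
-/

open Matrix

namespace Literature.NumberTheory.Automorphic

variable {K : Type*} [Field K] {n : ℕ}

/-- `(P_ρ M)_{ij} = M_{ρ i, j}`. [folklore] -/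
theorem permGL_mul_apply (ρ : Equiv.Perm (Fin n)) (M : Matrix (Fin n) (Fin n) K) (i j : Fin n) :
    (((permGL ρ : GL (Fin n) K) : Matrix (Fin n) (Fin n) K) * M) i j = M (ρ i) j := by
  rw [Matrix.mul_apply, Finset.sum_eq_single (ρ i)]
  · rw [coe_permGL, permMatrix_apply', if_pos rfl, one_mul]
  · intro k _ hk
    rw [coe_permGL, permMatrix_apply', if_neg (Ne.symm hk), zero_mul]
  · exact fun h => absurd (Finset.mem_univ _) h

/-- `(M P_ρ⁻¹)_{ij} = M_{i, ρ j}`. [folklore] -/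
theorem mul_permGL_inv_apply (ρ : Equiv.Perm (Fin n)) (M : Matrix (Fin n) (Fin n) K) (i j : Fin n) :
    (M * (((permGL ρ)⁻¹ : GL (Fin n) K) : Matrix (Fin n) (Fin n) K)) i j = M i (ρ j) := by
  have h := permGL_mul_mul_permGL_apply (K := K) (1 : Equiv.Perm (Fin n)) ρ⁻¹ M i j
  rw [permGL_one, Units.val_one, Matrix.one_mul, Equiv.Perm.one_apply, Equiv.Perm.inv_def, Equiv.symm_symm] at h
  rw [permGL_inv, Equiv.Perm.inv_def]
  exact h

/-- **Lower unitriangular matrices** (unit diagonal, zero above it), as a predicate. [folklore] -/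
def IsLowerUnitriangular (N : Matrix (Fin n) (Fin n) K) : Prop :=
  (∀ i, N i i = 1) ∧ ∀ i j, i < j → N i j = 0

/-- **The cell `C_σ` is cut out linearly in `P_σ N⁻`** (rank form): if `N` is lower unitriangular and
`swRank (P_σ N) = blockCount σ`, then `N_{kl} = 0` whenever `l < k` and `σ⁻¹ l < σ⁻¹ k`.
[cite: FultonYoungTableaux1997, §10.2 (PDF p. 150)] -/
theorem IsLowerUnitriangular.entry_eq_zero_of_swRank_eq {σ : Equiv.Perm (Fin n)}
    {N : Matrix (Fin n) (Fin n) K} (hN : IsLowerUnitriangular N)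
    (h : swRank (_root_.id : Fin n → Fin n) ((((permGL σ : GL (Fin n) K)) : Matrix (Fin n) (Fin n) K) * N) =
      blockCount (_root_.id : Fin n → Fin n) σ)
    {k l : Fin n} (hkl : l < k) (hσ : σ.symm l < σ.symm k) : N k l = 0 := by
  classical
  by_contra hne
  set M : Matrix (Fin n) (Fin n) K := (((permGL σ : GL (Fin n) K)) : Matrix (Fin n) (Fin n) K) * N with hM
  have hMapply : ∀ i j, M i j = N (σ i) j := fun i j => by rw [hM, permGL_mul_apply]
  -- the row label `a = σ⁻¹ l + 1` and the column bound `l + 1`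
  have ha_lt : (σ.symm l : ℕ) + 1 < n := lt_of_le_of_lt (Nat.succ_le_of_lt hσ) (σ.symm k).2
  set a : Fin n := ⟨(σ.symm l : ℕ) + 1, ha_lt⟩ with ha
  have ha_le_iff : ∀ i : Fin n, a ≤ i ↔ σ.symm l < i := fun i => by
    rw [Fin.le_def, Fin.lt_def]; exact Iff.rfl
  -- the index set of the square block: the columns `c < l` with `σ⁻¹ c > σ⁻¹ l`, and `l`
  set Cs : Finset (Fin n) := insert l (Finset.univ.filter fun c : Fin n => c < l ∧ a ≤ σ.symm c) with hCs
  have hl_not : l ∉ (Finset.univ.filter fun c : Fin n => c < l ∧ a ≤ σ.symm c) := by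
    simp
  have hmemCs : ∀ {c : Fin n}, c ∈ Cs → c = l ∨ (c < l ∧ a ≤ σ.symm c) := fun {c} hc => by
    rcases Finset.mem_insert.1 hc with hc | hc
    · exact Or.inl hc
    · exact Or.inr (by simpa using hc)
  have hle_l : ∀ {c : Fin n}, c ∈ Cs → c ≤ l := fun hc => by
    rcases hmemCs hc with rfl | ⟨hc, _⟩
    · exact le_rfl
    · exact hc.le
  -- rows and columns of the block inside the south-west block at `(a, l + 1)`
  let rowOf : ↥Cs → {i : Fin n // a ≤ _root_.id i} := fun c =>
    if hc : (c : Fin n) = l then ⟨σ.symm k, (ha_le_iff _).2 hσ⟩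
    else ⟨σ.symm c, by
      rcases hmemCs c.2 with h' | ⟨_, h'⟩
      · exact absurd h' hc
      · exact h'⟩
  let colOf : ↥Cs → {c : Fin n // (c : ℕ) < (l : ℕ) + 1} := fun c =>
    ⟨c, Nat.lt_succ_of_le (Fin.le_def.1 (hle_l c.2))⟩
  set S : Matrix ↥Cs ↥Cs K := (swBlock (_root_.id : Fin n → Fin n) M a ((l : ℕ) + 1)).submatrix rowOf colOf
    with hS
  have hSapply : ∀ c c' : ↥Cs, S c c' = if (c : Fin n) = l then N k c' else N c c' := by
    intro c c'
    rw [hS, Matrix.submatrix_apply, swBlock_apply]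
    by_cases hc : (c : Fin n) = l
    · rw [if_pos hc]
      simp only [rowOf, dif_pos hc, colOf]
      rw [hMapply, Equiv.apply_symm_apply]
    · rw [if_neg hc]
      simp only [rowOf, dif_neg hc, colOf]
      rw [hMapply, Equiv.apply_symm_apply]
  -- `S` is lower triangular with non-zero diagonal
  have hSlow : S.BlockTriangular ⇑OrderDual.toDual := by
    intro c c' hcc'
    have hlt : (c : Fin n) < (c' : Fin n) := by
      have : c < c' := OrderDual.toDual_lt_toDual.1 hcc'
      exact this
    rw [hSapply]
    by_cases hc : (c : Fin n) = l
    · exact absurd (lt_of_lt_of_le (hc ▸ hlt) (hle_l c'.2)) (lt_irrefl _)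
    · rw [if_neg hc]
      exact hN.2 _ _ hlt
  have hSdiag : ∀ c : ↥Cs, S c c ≠ 0 := by
    intro c
    rw [hSapply]
    by_cases hc : (c : Fin n) = l
    · rw [if_pos hc, hc]; exact hne
    · rw [if_neg hc, hN.1]; exact one_ne_zero
  have hdet : S.det ≠ 0 := by
    rw [Matrix.det_of_lowerTriangular S hSlow]
    exact Finset.prod_ne_zero_iff.2 fun c _ => hSdiag c
  have hrankS : S.rank = Fintype.card ↥Cs :=
    Matrix.rank_of_isUnit S ((Matrix.isUnit_iff_isUnit_det S).2 (isUnit_iff_ne_zero.2 hdet))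
  have hrank_le : S.rank ≤ swRank (_root_.id : Fin n → Fin n) M a ((l : ℕ) + 1) := by
    rw [hS, swRank]
    exact Matrix.rank_submatrix_le _ _ _
  -- the block count at `(a, l + 1)` is `#Cs - 1`
  have hcard : Fintype.card ↥Cs = blockCount (_root_.id : Fin n → Fin n) σ a ((l : ℕ) + 1) + 1 := by
    rw [Fintype.card_coe, hCs, Finset.card_insert_of_notMem hl_not, blockCount]
    congr 1
    refine Finset.card_bij (fun c _ => σ.symm c) (fun c hc => ?_) (fun c₁ _ c₂ _ h => by simpa using h)
      (fun i hi => ?_)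
    · simp only [Finset.mem_filter, Finset.mem_univ, true_and] at hc ⊢
      refine ⟨hc.2, ?_⟩
      rw [Equiv.apply_symm_apply]
      exact Nat.lt_succ_of_lt (Fin.lt_def.1 hc.1)
    · simp only [Finset.mem_filter, Finset.mem_univ, true_and] at hi
      refine ⟨σ i, ?_, by simp⟩
      simp only [Finset.mem_filter, Finset.mem_univ, true_and, Equiv.symm_apply_apply]
      refine ⟨?_, hi.1⟩
      rcases (Nat.lt_succ_iff_lt_or_eq.1 hi.2) with h' | h'
      · exact Fin.lt_def.2 h'
      · exfalso
        have h'' : σ i = l := Fin.ext h'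
        have : a ≤ σ.symm l := by rw [← h'', Equiv.symm_apply_apply]; exact hi.1
        exact absurd ((ha_le_iff _).1 this) (lt_irrefl _)
  have hsw : swRank (_root_.id : Fin n → Fin n) M a ((l : ℕ) + 1) = blockCount (_root_.id : Fin n → Fin n) σ a ((l : ℕ) + 1) :=
    congrFun (congrFun h a) _
  omega

/-- The conjugate `d⁻¹ N d` of a lower unitriangular matrix by an invertible diagonal matrix is lower
unitriangular, with entries `d_k⁻¹ N_{kl} d_l`. [folklore] -/
theorem IsLowerUnitriangular.diagonal_conj {N : Matrix (Fin n) (Fin n) K} (hN : IsLowerUnitriangular N)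
    (d : Fin n → Kˣ) :
    IsLowerUnitriangular (Matrix.diagonal (fun i => ((d i)⁻¹ : Kˣ) : Fin n → K) * N *
      Matrix.diagonal (fun i => (d i : K))) := by
  refine ⟨fun i => ?_, fun i j hij => ?_⟩
  · rw [Matrix.mul_diagonal, Matrix.diagonal_mul, hN.1, mul_one, Units.inv_mul]
  · rw [Matrix.mul_diagonal, Matrix.diagonal_mul, hN.2 i j hij, mul_zero, zero_mul]

/-- **`C_σ ∩ P_σ N⁻ B ⊆ P_σ (N⁻ ∩ P_σ⁻¹ U_n P_σ) B`**: if `P_σ N d u ∈ C_σ` with `N` lower unitriangular,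
`d` diagonal invertible and `u ∈ U_n`, then `N_{kl} = 0` for `l < k`, `σ⁻¹ l < σ⁻¹ k`.
[cite: FultonYoungTableaux1997, §10.2 (PDF p. 150)] -/
theorem entry_eq_zero_of_permGL_mul_mem_bruhatCell {σ : Equiv.Perm (Fin n)} {N : GL (Fin n) K}
    (hN : IsLowerUnitriangular (N : Matrix (Fin n) (Fin n) K)) (d : Fin n → Kˣ) {u : GL (Fin n) K}
    (hu : u ∈ upperUnitriangular (Fin n) K)
    (hmem : permGL σ * N * diagonalGL (Fin n) K d * u ∈ bruhatCell (K := K) σ)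
    {k l : Fin n} (hkl : l < k) (hσ : σ.symm l < σ.symm k) : (N : Matrix (Fin n) (Fin n) K) k l = 0 := by
  -- move the torus to the left: `P_σ N d u = (P_σ d P_σ⁻¹) · (P_σ (d⁻¹ N d)) · u`
  set N' : GL (Fin n) K := (diagonalGL (Fin n) K d)⁻¹ * N * diagonalGL (Fin n) K d with hN'
  have hN'low : IsLowerUnitriangular ((N' : GL (Fin n) K) : Matrix (Fin n) (Fin n) K) := by
    rw [hN', Units.val_mul, Units.val_mul, ← map_inv, coe_diagonalGL, coe_diagonalGL]
    exact hN.diagonal_conj d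
  have hfact : permGL σ * N * diagonalGL (Fin n) K d * u =
      (permGL σ * diagonalGL (Fin n) K d * (permGL σ)⁻¹) * (permGL σ * N') * u := by
    rw [hN']; group
  have hB : permGL σ * diagonalGL (Fin n) K d * (permGL σ)⁻¹ ∈
      standardParabolicGL K (_root_.id : Fin n → Fin n) := by
    rw [permGL_mul_diagonalGL_mul_permGL_inv]
    exact diagonalGL_mem_borel _
  have hrank := (mem_parabolicDoubleCoset_iff_swRank_eq (K := K) _ monotone_id σ _).1 hmem
  rw [hfact, swRank_parabolic_mul_mul_upperUnitriangular _ hB hu, Units.val_mul] at hrank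
  have h0 := hN'low.entry_eq_zero_of_swRank_eq hrank hkl hσ
  rw [hN', Units.val_mul, Units.val_mul, ← map_inv, coe_diagonalGL, coe_diagonalGL, Matrix.mul_diagonal,
    Matrix.diagonal_mul] at h0
  simpa using h0

/-- **Conversely, `P_σ (N⁻ ∩ P_σ⁻¹ U_n P_σ) B ⊆ C_σ`**: if `N` is lower unitriangular with `N_{kl} = 0`
whenever `l < k` and `σ⁻¹ l < σ⁻¹ k`, then `P_σ N d u ∈ C_σ`. [folklore] -/
theorem permGL_mul_mem_bruhatCell_of_entry_eq_zero {σ : Equiv.Perm (Fin n)} {N : GL (Fin n) K}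
    (hN : IsLowerUnitriangular (N : Matrix (Fin n) (Fin n) K))
    (hz : ∀ k l : Fin n, l < k → σ.symm l < σ.symm k → (N : Matrix (Fin n) (Fin n) K) k l = 0)
    (d : Fin n → Kˣ) {u : GL (Fin n) K} (hu : u ∈ upperUnitriangular (Fin n) K) :
    permGL σ * N * diagonalGL (Fin n) K d * u ∈ bruhatCell (K := K) σ := by
  -- `P_σ N d u = (P_σ N P_σ⁻¹) P_σ (d u)` with `P_σ N P_σ⁻¹ ∈ U_n ≤ B`
  have hconj : permGL σ * N * (permGL σ)⁻¹ ∈ upperUnitriangular (Fin n) K := by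
    rw [mem_upperUnitriangular_iff]
    refine ⟨fun i j hij => ?_, fun i => ?_⟩
    · rw [Units.val_mul, mul_permGL_inv_apply, Units.val_mul, permGL_mul_apply]
      -- `j < i`; entry `N (σ i) (σ j)`
      have hij' : j < i := hij
      by_cases hcase : σ j < σ i
      · exact hz _ _ hcase (by simpa using hij')
      · rcases lt_or_eq_of_le (not_lt.1 hcase) with h' | h'
        · exact hN.2 _ _ h'
        · exact absurd (σ.injective h') (ne_of_gt hij')
    · rw [Units.val_mul, mul_permGL_inv_apply, Units.val_mul, permGL_mul_apply, hN.1]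
  have hB : permGL σ * diagonalGL (Fin n) K d * (permGL σ)⁻¹ ∈
      standardParabolicGL K (_root_.id : Fin n → Fin n) := by
    rw [permGL_mul_diagonalGL_mul_permGL_inv]
    exact diagonalGL_mem_borel _
  have hfact : permGL σ * N * diagonalGL (Fin n) K d * u =
      (permGL σ * N * (permGL σ)⁻¹) * (permGL σ * diagonalGL (Fin n) K d * (permGL σ)⁻¹) * permGL σ * u := by
    group
  rw [hfact]
  exact ⟨(permGL σ * N * (permGL σ)⁻¹) * (permGL σ * diagonalGL (Fin n) K d * (permGL σ)⁻¹),
    Subgroup.mul_mem _ (upperUnitriangular_le_borel hconj) hB, u, hu, rfl⟩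

end Literature.NumberTheory.Automorphic
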